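import Summits.QuantumAdvantage.QuantumAdvantage.Theorems.CubicForrelationNearExactIsExactFiveFlatLemma
import Summits.QuantumAdvantage.QuantumAdvantage.Theorems.CubicForrelationNearExactIsExactTwelveTypeO512DeadAt2932
import Summits.QuantumAdvantage.QuantumAdvantage.Theorems.CubicForrelationNearExactIsExactTwelveLevelFiveGenericDeadAt2932
import Summits.QuantumAdvantage.QuantumAdvantage.Theorems.CubicForrelationNearExactIsExactTwelveTypeO960LevelSixAt2932
import Summits.QuantumAdvantage.QuantumAdvantage.Theorems.CubicForrelationNearExactIsExactTwelveTypeO992LevelFiveAt2932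
import Summits.QuantumAdvantage.QuantumAdvantage.Theorems.NearExactIsExact.Negative.AffineDigitCaseAFourteen

/-!
# Crux `CubicForrelation.NearExactIsExact` (stmt-QuantumAdvantage-14043) — n = 12 AT `Φ = 29/32`: the type-O base `1024` (ZERO EXCESS)
  is DEAD; hence NO TYPE-O SIDE at `Φ ≥ 29/32` on 12 bits

Certificate seat `b2b-cforr-cert` (gen 23).  HONEST FRAMING: a kernel-checked finite-slice theorem (standard axioms, no `decide`) about cubic
Boolean pairs on 12 bits — it closes the LAST type-O configuration of the boundary rung `29/32 = 928/1024` (gen 22 killed the bases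
`512/768/896/960/992`: p319787, p320506 + `…TypeO768DeadAt2932`, p320093, p319369, p319909).  So at `Φ ≥ 29/32` a cubic pair on 12 bits
has BOTH sides at Ax level `≥ 5` (`W ∈ 32ℤ`).  Whether `29/32` is a value at `n = 12` is NOT decided here (the rigid level-5
configurations R1/R2 and level `≥ 6` × level `≥ 6` at `Σ e² = 768` remain, HOME/b2b-cforr-cert-g22/PLAN-N12-928-EQ.md).  NO new value of
`θ₁₂`; NOT summit progress.  Paper proof: HOME/b2b-cforr-cert-g23/PROOF-N12-928-O1024.md.

THE ARGUMENT.  Zero excess (`to21_typeO_E1024_zero_excess`) says `u − 4(−1)^f = (−1)^{d₁}(1 − 4·1_E)` pointwise, `d₁` the affine digit,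
`E = {d₁ = d₂}` the support of the cubic `e = 1 ⊕ d₁ ⊕ d₂`, `#E = 1024`.  Normalising (`g ↦ g(· ⊕ c₁) ⊕ b₁`, `f ↦ f ⊕ d₁`, where
`(−1)^{d₁(a)} = (−1)^{b₁}(−1)^{c₁·a}`) gives three cubics `f, g, e` with

  (*)  `W_g(a) = 16 + 64(−1)^{f(a)} − 64·e(a)`  for all `a`   (`to23_core_false` refutes exactly this).

1. (`to23_core_h5`) Every parametrised 5-flat meets `E` in `≡ 0 (mod 4)` points: `fs_flat_sum_dvd` (`j = 4, k = 5, e = 4`) gives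
   `16 ∣ Σ_flat u = 32 + 4·Σ_flat (−1)^f − 4·#(E ∩ flat)`, and Ax on the pulled-back cubic `f` (`fs_sum_signOf_flat_dvd`) gives `4 ∣ Σ_flat (−1)^f`.
2. (`to23_core_charsum`) Hence, by the FIVE-FLAT LEMMA `ffl_weight` (m = 11) applied to the restrictions of `e` to both sides of every
   hyperplane pair (`ffl_restrict`; the smaller side has `< 512 = 2^{11}/4` points unless both have `512`): `Ê(y) = #E − 2·#(E ∩ {⟨x,y⟩ odd})
   ∈ {0, ±512, ±1024}` for `y ≠ 0`, so `|Ê(y)| ≤ Ê(y)²/512`.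
3. Fourier inversion of (*): `W_f(y) = 64(−1)^{g(y)} − 1024·[y = 0] + Ê(y)`; Parseval for `f` and for `E` (`Σ_y Ê² = 2¹²·1024`) give
   `Σ_{y≠0} (−1)^{g(y)} Ê(y) = −24576`, whereas step 2 bounds the left side below by `−Σ_{y≠0} Ê²/512 = −6144`.  Contradiction.

Main statements: `to23_core_false`, `to23_typeO_E1024_ge2932_false`, `to23_typeO_ge2932_false` (NO type-O side at `Φ ≥ 29/32`),
`tw23_ge2932_levelFive` (both sides have `W ∈ 32ℤ`).

References: T. Kasami, N. Tokura (1970) (through `kt3_weights_all`); J. Ax (1964) / R. J. McEliece (1972); MacWilliams–Sloane (1977) Ch. 13–15;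
R. O'Donnell (2014) §1.4, §3.3.  Axioms: the standard three.
-/

set_option linter.dupNamespace false -- D-0017: single-problem summit ⇒ `QuantumAdvantage.QuantumAdvantage` by design

noncomputable section

namespace Summit.QuantumAdvantage.QuantumAdvantage.Theorems.CubicForrelation.NearExactIsExact

open Finset
open Literature.Computability.QuantumComplexity
open Literature.Computability.QuantumComplexity.BuzetChailloux (bxor zeroVec bxor_bxor_cancel_left bxor_zeroVec zeroVec_bxor bxor_comm
  bxor_self twist_zeroVec_right twist_bxor_right signOf_sq)
open Literature.Computability.QuantumComplexity.DerivativeWalsh (W sum_W_sq twist_bxor_left)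
open Literature.Computability.QuantumComplexity.Simon (twist_eq_one_or)
open Summit.QuantumAdvantage.QuantumAdvantage.Theorems.SignedCubicForrelationNotPrBPP (knf_isDegLeFun_ip knf_isDegLeFun_comp)
open Summit.QuantumAdvantage.QuantumAdvantage.Theorems.NearExactIsExact.Negative (TypeOTwelve.typeO_of_exists_odd)
open Summit.QuantumAdvantage.QuantumAdvantage.Theorems.NearExactIsExact.Negative (AffineDigitCaseAFourteen.ad_W_translate)

/-! ### The normalised configuration `W_g = 16 + 64(−1)^f − 64e` -/

/-- **Step 1: the 5-flat property of `E`.**  Cubic `f, g, e` on 12 bits with `W_g = 16 + 64(−1)^f − 64e`: every parametrised 5-flat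
carries `≡ 0 (mod 4)` points of `E = {e = 1}`.  [this work] -/
theorem to23_core_h5 (f g e : (Fin (6 + 6) → Bool) → Bool) (hf : IsDegLeFun 3 f) (hg : IsDegLeFun 3 g)
    (hW : ∀ a, W (fun y => signOf (g y)) a = 16 + 64 * signOf (f a) - 64 * (if e a = true then 1 else 0))
    (b : Fin (6 + 6) → Bool) (a : Fin 5 → Fin (6 + 6) → Bool) :
    4 ∣ #(univ.filter fun ε : Fin 5 → Bool =>
      e (fun j => b j ^^ decide (Odd #(univ.filter fun i => ε i && a i j))) = true) := by
  classical
  set u : (Fin (6 + 6) → Bool) → ℤ := fun x => 1 + 4 * sZ (f x) - 4 * (if e x = true then 1 else 0) with hudef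
  have hu : ∀ x, W (fun y => signOf (g y)) x = (2 : ℝ) ^ 4 * (u x : ℝ) := by
    intro x
    rw [hW x]
    simp only [u]
    push_cast
    rw [tp_sZ_cast]
    split_ifs <;> ring
  have hdvd := fs_flat_sum_dvd (k := 5) (j := 4) (e := 4) g u hg hu b a (by norm_num)
  obtain ⟨z, hz⟩ := fs_sum_signOf_flat_dvd f hf b a
  have hz' : ∑ ε : Fin 5 → Bool, sZ (f (fun j => b j ^^ decide (Odd #(univ.filter fun i => ε i && a i j)))) = 4 * z := by
    have h : ((∑ ε : Fin 5 → Bool, sZ (f (fun j => b j ^^ decide (Odd #(univ.filter fun i => ε i && a i j)))) : ℤ) : ℝ) =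
        ((4 * z : ℤ) : ℝ) := by
      push_cast
      rw [sum_congr rfl fun ε _ => tp_sZ_cast _, hz]
      norm_num
    exact_mod_cast h
  have hcount : ∑ ε : Fin 5 → Bool,
      (if e (fun j => b j ^^ decide (Odd #(univ.filter fun i => ε i && a i j))) = true then (1 : ℤ) else 0) =
      #(univ.filter fun ε : Fin 5 → Bool => e (fun j => b j ^^ decide (Odd #(univ.filter fun i => ε i && a i j))) = true) := by
    rw [sum_boole]
  have hexp : ∑ ε : Fin 5 → Bool, u (fun j => b j ^^ decide (Odd #(univ.filter fun i => ε i && a i j))) =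
      32 + 4 * (4 * z) - 4 * #(univ.filter fun ε : Fin 5 → Bool =>
        e (fun j => b j ^^ decide (Odd #(univ.filter fun i => ε i && a i j))) = true) := by
    simp only [u]
    rw [sum_sub_distrib, sum_add_distrib, sum_const, card_univ, Fintype.card_fun, Fintype.card_bool, Fintype.card_fin,
      ← mul_sum, ← mul_sum, hz', hcount]
    norm_num
  rw [hexp] at hdvd
  have h16 : (2 : ℤ) ^ 4 = 16 := by norm_num
  rw [h16] at hdvd
  have h4 : (4 : ℤ) ∣ (#(univ.filter fun ε : Fin 5 → Bool =>
      e (fun j => b j ^^ decide (Odd #(univ.filter fun i => ε i && a i j))) = true) : ℤ) := by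
    omega
  exact_mod_cast h4

/-- **Step 2: the character sums of `E`.**  In the setting of `to23_core_h5` with `#E = 1024` and `e` cubic: for `y ≠ 0`,
`Ê(y) = Σ_{x∈E} (−1)^{x·y} ∈ {0, ±512, ±1024}` (five-flat lemma on both hyperplane sections).  [this work] -/
theorem to23_core_charsum (f g e : (Fin (6 + 6) → Bool) → Bool) (hf : IsDegLeFun 3 f) (hg : IsDegLeFun 3 g) (he : IsDegLeFun 3 e)
    (hE : #(univ.filter fun x : Fin (6 + 6) → Bool => e x = true) = 1024)
    (hW : ∀ a, W (fun y => signOf (g y)) a = 16 + 64 * signOf (f a) - 64 * (if e a = true then 1 else 0))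
    (y : Fin (6 + 6) → Bool) (hy : y ≠ zeroVec) :
    ∑ x ∈ univ.filter (fun x : Fin (6 + 6) → Bool => e x = true), twist x y = 0 ∨
      ∑ x ∈ univ.filter (fun x : Fin (6 + 6) → Bool => e x = true), twist x y = 512 ∨
      ∑ x ∈ univ.filter (fun x : Fin (6 + 6) → Bool => e x = true), twist x y = -512 ∨
      ∑ x ∈ univ.filter (fun x : Fin (6 + 6) → Bool => e x = true), twist x y = 1024 ∨
      ∑ x ∈ univ.filter (fun x : Fin (6 + 6) → Bool => e x = true), twist x y = -1024 := by
  classical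
  have h5 := to23_core_h5 f g e hf hg hW
  have hF := ktg_F_half e y
  have hadd := ktg_half_add e y
  rw [hE] at hF hadd
  set N₁ := #(univ.filter fun x => e x = true ∧ decide (Odd #(univ.filter fun i => (x i && y i) = true)) = true) with hN₁
  set N₀ := #(univ.filter fun x => e x = true ∧ decide (Odd #(univ.filter fun i => (x i && y i) = true)) = false) with hN₀
  obtain ⟨i₀, hi₀⟩ : ∃ i, y i = true := by
    by_contra h
    push Not at h
    exact hy (funext fun i => by simpa [zeroVec] using h i)
  have hsec : ∀ β : Bool, 4 * #(univ.filter fun x => e x = true ∧ decide (Odd #(univ.filter fun i => (x i && y i) = true)) = β) < 2 ^ 11 →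
      #(univ.filter fun x => e x = true ∧ decide (Odd #(univ.filter fun i => (x i && y i) = true)) = β) = 0 ∨
      #(univ.filter fun x => e x = true ∧ decide (Odd #(univ.filter fun i => (x i && y i) = true)) = β) = 256 := by
    intro β hlt
    obtain ⟨c', hc', h5', hcard'⟩ := ffl_restrict (k := 11) e he h5 y i₀ hi₀ β
    have h := ffl_weight 11 (by norm_num) c' hc' h5' (by rw [hcard']; exact hlt)
    rw [hcard'] at h
    have e8 : (2 : ℕ) ^ (11 - 3) = 256 := by norm_num
    rw [e8] at h
    exact h
  rw [hF]
  push_cast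
  rcases Nat.lt_trichotomy N₁ 512 with h1 | h1 | h1
  · have hv := hsec true (by rw [← hN₁]; norm_num; omega)
    rw [← hN₁] at hv
    rcases hv with hv | hv
    · right; right; right; left; rw [hv]; norm_num
    · right; left; rw [hv]; norm_num
  · left; rw [h1]; norm_num
  · have hv := hsec false (by rw [← hN₀]; norm_num; omega)
    rw [← hN₀] at hv
    rcases hv with hv | hv
    · right; right; right; right
      have : (N₁ : ℝ) = 1024 := by exact_mod_cast (by omega : N₁ = 1024)
      rw [this]; norm_num
    · right; right; left
      have : (N₁ : ℝ) = 768 := by exact_mod_cast (by omega : N₁ = 768)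
      rw [this]; norm_num

/-- **The core contradiction.**  Three cubics `f, g, e` on 12 bits with `#{e = 1} = 1024` and `W_g = 16 + 64(−1)^f − 64e` pointwise do
not exist.  (The normalised form of a type-O side with base set `1024` at `Φ = 29/32`.)  [this work] -/
theorem to23_core_false (f g e : (Fin (6 + 6) → Bool) → Bool) (hf : IsDegLeFun 3 f) (hg : IsDegLeFun 3 g) (he : IsDegLeFun 3 e)
    (hE : #(univ.filter fun x : Fin (6 + 6) → Bool => e x = true) = 1024)
    (hW : ∀ a, W (fun y => signOf (g y)) a = 16 + 64 * signOf (f a) - 64 * (if e a = true then 1 else 0)) : False := by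
  classical
  set S := univ.filter (fun x : Fin (6 + 6) → Bool => e x = true) with hSdef
  set F : (Fin (6 + 6) → Bool) → ℝ := fun y => ∑ x ∈ S, twist x y with hFdef
  -- values of `F` off zero and the pointwise bound `−F²/512 ≤ (−1)^g F`
  have hbound : ∀ y, y ≠ zeroVec → -(F y ^ 2) / 512 ≤ signOf (g y) * F y := by
    intro y hy
    have hv := to23_core_charsum f g e hf hg he hE hW y hy
    change F y = 0 ∨ F y = 512 ∨ F y = -512 ∨ F y = 1024 ∨ F y = -1024 at hv
    have hs : signOf (g y) = 1 ∨ signOf (g y) = -1 := by unfold signOf; cases g y <;> simp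
    rcases hs with hs | hs <;> rw [hs] <;> rcases hv with h | h | h | h | h <;> rw [h] <;> norm_num
  -- `F(0) = 1024` and Parseval for `E`
  have hF0 : F zeroVec = 1024 := by
    simp only [F]
    rw [sum_congr rfl fun x _ => twist_zeroVec_right x, sum_const, nsmul_eq_mul, mul_one, hE]
    norm_num
  have hPE : ∑ y, F y ^ 2 = 2 ^ (6 + 6) * 1024 := by
    have h := ktg_parseval S
    rw [hE] at h
    exact_mod_cast h
  -- Fourier inversion of (*): `W_f(y) = 64(−1)^g − 1024·[y=0] + F(y)`
  have hWf : ∀ y, W (fun x => signOf (f x)) y =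
      64 * signOf (g y) - (if y = zeroVec then 1024 else 0) + F y := by
    intro y
    have hsf : ∀ a, signOf (f a) = (W (fun y => signOf (g y)) a - 16 + 64 * (if e a = true then 1 else 0)) / 64 := by
      intro a; rw [hW a]; ring
    unfold W
    show ∑ a, signOf (f a) * twist a y = _
    rw [sum_congr rfl fun a _ => by rw [hsf a]]
    have e1 : ∑ a, (W (fun y => signOf (g y)) a - 16 + 64 * (if e a = true then (1 : ℝ) else 0)) / 64 * twist a y =
        (∑ a, W (fun y => signOf (g y)) a * twist a y) / 64 - (∑ a, twist a y) / 4 +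
          ∑ a, (if e a = true then (1 : ℝ) else 0) * twist a y := by
      rw [sum_div, sum_div, ← sum_sub_distrib, ← sum_add_distrib]
      exact sum_congr rfl fun a _ => by ring
    rw [e1, tz_inversion, tz_sum_twist_left]
    have e2 : ∑ a, (if e a = true then (1 : ℝ) else 0) * twist a y = F y := by
      simp only [F, hSdef]
      rw [sum_filter]
      exact sum_congr rfl fun a _ => by split_ifs <;> simp
    rw [e2]
    change (2 : ℝ) ^ (6 + 6) * signOf (g y) / 64 - (if y = zeroVec then (2 : ℝ) ^ (6 + 6) else 0) / 4 + F y = _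
    have h4096 : (2 : ℝ) ^ (6 + 6) = 4096 := by norm_num
    rw [h4096]
    split_ifs <;> ring
  -- Parseval for `f`
  have hPf : ∑ y, W (fun x => signOf (f x)) y ^ 2 = 2 ^ (6 + 6) * 2 ^ (6 + 6) := by
    rw [sum_W_sq]
    simp_rw [signOf_sq]
    norm_num
  -- split both Parseval sums at `y = 0`
  have hsplitW := (add_sum_erase univ (fun y => W (fun x => signOf (f x)) y ^ 2) (mem_univ zeroVec)).symm
  have hsplitF := (add_sum_erase univ (fun y => F y ^ 2) (mem_univ zeroVec)).symm
  rw [hsplitW] at hPf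
  rw [hsplitF] at hPE
  have hW0 : W (fun x => signOf (f x)) zeroVec ^ 2 = 4096 := by
    rw [hWf, if_pos rfl, hF0]
    have hs : signOf (g zeroVec) = 1 ∨ signOf (g zeroVec) = -1 := by unfold signOf; cases g zeroVec <;> simp
    rcases hs with h | h <;> rw [h] <;> norm_num
  have hWy : ∀ y ∈ univ.erase zeroVec, W (fun x => signOf (f x)) y ^ 2 = 4096 + 128 * (signOf (g y) * F y) + F y ^ 2 := by
    intro y hy
    rw [hWf, if_neg (ne_of_mem_erase hy)]
    have hs2 : signOf (g y) ^ 2 = 1 := signOf_sq _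
    nlinarith [hs2]
  rw [hW0, sum_congr rfl hWy, sum_add_distrib, sum_add_distrib, sum_const, ← mul_sum] at hPf
  rw [hF0] at hPE
  have hcardE : #(univ.erase (zeroVec : Fin (6 + 6) → Bool)) = 4095 := by
    rw [card_erase_of_mem (mem_univ _), card_univ, Fintype.card_fun, Fintype.card_bool, Fintype.card_fin]
    norm_num
  rw [hcardE, nsmul_eq_mul] at hPf
  -- the signed sum is `−24576`, but bounded below by `−6144`
  set X := ∑ y ∈ univ.erase zeroVec, signOf (g y) * F y with hXdef
  set Y := ∑ y ∈ univ.erase zeroVec, F y ^ 2 with hYdef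
  have hX : X = -24576 := by
    norm_num at hPf hPE
    linarith
  have hlow : ∑ y ∈ univ.erase zeroVec, -(F y ^ 2) / 512 ≤ ∑ y ∈ univ.erase zeroVec, signOf (g y) * F y :=
    sum_le_sum fun y hy => hbound y (ne_of_mem_erase hy)
  have e3 : ∑ y ∈ univ.erase zeroVec, -(F y ^ 2) / 512 = -Y / 512 := by
    rw [← sum_div, sum_neg_distrib]
  rw [e3] at hlow
  change -Y / 512 ≤ X at hlow
  norm_num at hPE
  have hE2 : Y = 3145728 := by linarith
  rw [hE2, hX] at hlow
  norm_num at hlow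

/-! ### From a type-O side with base set `1024` to the normalised configuration -/

/-- **The type-O base `1024` is DEAD at `Φ ≥ 29/32`** (12 bits): cubic `f, g`, `W_g = 16u` with some `u(x)` odd, base set
`#E = 1024` (`E = {[⌊u/2⌋ odd] = [⌊u/4⌋ odd]}`), `Φ(f,g) ≥ 29/32` is impossible.  Proof: zero excess (`to21_typeO_E1024_zero_excess`),
normalisation `g ↦ g(· ⊕ c₁) ⊕ b₁`, `f ↦ f ⊕ d₁` (translation covariance `ad_W_translate`) to the configuration
`W_g = 16 + 64(−1)^f − 64e`, and `to23_core_false`.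
Finite-slice statement, NOT summit progress. [this work] -/
theorem to23_typeO_E1024_ge2932_false (f g : (Fin (6 + 6) → Bool) → Bool) (hf : IsDegLeFun 3 f) (hg : IsDegLeFun 3 g)
    (u : (Fin (6 + 6) → Bool) → ℤ) (hu : ∀ x, W (fun y => signOf (g y)) x = (2 : ℝ) ^ 4 * (u x : ℝ))
    (hodd : ∃ x, Odd (u x)) (hE : #(univ.filter fun x : Fin (6 + 6) → Bool => (Odd (u x / 2) ↔ Odd (u x / 2 / 2))) = 1024)
    (hΦ : (29 / 32 : ℝ) ≤ forrelation f g) : False := by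
  classical
  have hall : ∀ x, Odd (u x) := TypeOTwelve.typeO_of_exists_odd g u hg hu hodd
  have hu' : ∀ x, W (fun y => signOf (g y)) x = (2 : ℝ) ^ (2 * 2) * (u x : ℝ) := fun x => (hu x).trans (by norm_num)
  have hd1 : IsDegLeFun 1 (fun x => decide (Odd (u x / 2))) := z2_digitOne 2 g u hg hu' hall
  have hd2 : IsDegLeFun 3 (fun x => decide (Odd (u x / 2 / 2))) := z2_digitTwo 2 g u hg hu' hall
  obtain ⟨c₁, b₁, hcb⟩ := stub_affineForm (6 + 6) _ hd1
  obtain ⟨-, hτ, -⟩ := to21_typeO_E1024_zero_excess f g hg u hu hodd hE hΦ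
  -- the cubic `e = 1 ⊕ d₁ ⊕ d₂` with support `E`
  set e : (Fin (6 + 6) → Bool) → Bool :=
    fun x => (decide (Odd (u x / 2)) ^^ decide (Odd (u x / 2 / 2))) ^^ true with hedef
  have he : IsDegLeFun (2 + 1) e := tb_isDegLeFun_xor_const (bb_isDegLeFun_bxor (hd1.mono (by norm_num)) hd2) true
  have heiff : ∀ x, e x = true ↔ (Odd (u x / 2) ↔ Odd (u x / 2 / 2)) := by
    intro x
    simp only [e]
    by_cases h1 : Odd (u x / 2) <;> by_cases h2 : Odd (u x / 2 / 2) <;> simp [h1, h2]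
  have hE' : #(univ.filter fun x => e x = true) = 1024 := by
    rw [← hE]
    exact congrArg card (filter_congr fun x _ => heiff x)
  -- the normalised pair
  set f' : (Fin (6 + 6) → Bool) → Bool := fun x => f x ^^ decide (Odd (u x / 2)) with hf'def
  have hf' : IsDegLeFun 3 f' := bb_isDegLeFun_bxor hf (hd1.mono (by norm_num))
  set g' : (Fin (6 + 6) → Bool) → Bool := fun y => g (bxor y c₁) ^^ b₁ with hg'def
  have hg' : IsDegLeFun 3 g' :=
    tb_isDegLeFun_xor_const (knf_isDegLeFun_comp hg (fun y => bxor y c₁)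
      (fun j => bb_isDegLeFun_bxor (isDegLeFun_apply j le_rfl) (isDegLeFun_const 1 (c₁ j)))) b₁
  have hW' : ∀ a, W (fun y => signOf (g' y)) a = 16 + 64 * signOf (f' a) - 64 * (if e a = true then 1 else 0) := by
    intro a
    have h1 : W (fun y => signOf (g' y)) a = signOf b₁ * twist c₁ a * W (fun y => signOf (g y)) a := by
      rw [mul_assoc, ← AffineDigitCaseAFourteen.ad_W_translate g c₁ a]
      unfold W
      rw [mul_sum]
      exact sum_congr rfl fun y _ => by simp only [g']; rw [signOf_xor]; ring
    rw [h1, hu a, ← hcb a]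
    have huR : (u a : ℝ) = 4 * signOf (f a) +
        signOf (decide (Odd (u a / 2))) * (1 - 4 * (if (Odd (u a / 2) ↔ Odd (u a / 2 / 2)) then 1 else 0)) := by
      have h := congrArg (fun z : ℤ => (z : ℝ)) (hτ a)
      push_cast at h
      rw [tp_sZ_cast, tp_sZ_cast] at h
      split_ifs at h ⊢ <;> linarith
    have hif : (if e a = true then (1 : ℝ) else 0) = (if (Odd (u a / 2) ↔ Odd (u a / 2 / 2)) then 1 else 0) := by
      by_cases h : (Odd (u a / 2) ↔ Odd (u a / 2 / 2))
      · rw [if_pos h, if_pos ((heiff a).2 h)]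
      · rw [if_neg h, if_neg (fun h' => h ((heiff a).1 h'))]
    have hsf' : signOf (f' a) = signOf (f a) * signOf (decide (Odd (u a / 2))) := by
      simp only [f']; rw [signOf_xor]
    rw [huR, hif, hsf']
    have hs : signOf (decide (Odd (u a / 2))) = 1 ∨ signOf (decide (Odd (u a / 2))) = -1 := by
      unfold signOf; cases decide (Odd (u a / 2)) <;> simp
    rcases hs with hs | hs <;> rw [hs] <;> split_ifs <;> norm_num <;> ring
  exact to23_core_false f' g' e hf' hg' he hE' hW'

/-! ### Assembly: no type-O side at `Φ ≥ 29/32` -/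

/-- **NO TYPE-O SIDE AT `Φ ≥ 29/32` on 12 bits.**  Cubic `f, g` with `W_g = 16u`, some `u(x)` odd, and `Φ(f,g) ≥ 29/32` do not exist:
by `to21_typeO_ge2932_shape` the base set has `512, 768, 896, 960, 992` or `1024` points; the first five are dead by gen 22
(`to22_typeO_E512_ge2932_false`, `…E768…`, `…E896…`, `…E960…`, `…E992…`), the last by `to23_typeO_E1024_ge2932_false`.
Finite-slice statement; whether `29/32` is a value at `n = 12` is NOT decided here.  NOT summit progress. [this work] -/
theorem to23_typeO_ge2932_false (f g : (Fin (6 + 6) → Bool) → Bool) (hf : IsDegLeFun 3 f) (hg : IsDegLeFun 3 g)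
    (u : (Fin (6 + 6) → Bool) → ℤ) (hu : ∀ x, W (fun y => signOf (g y)) x = (2 : ℝ) ^ 4 * (u x : ℝ))
    (hodd : ∃ x, Odd (u x)) (hΦ : (29 / 32 : ℝ) ≤ forrelation f g) : False := by
  obtain ⟨hshape, -, -, -⟩ := to21_typeO_ge2932_shape f g hg u hu hodd hΦ
  rcases hshape with h | h | h | h | h | ⟨h, -⟩
  · exact to22_typeO_E512_ge2932_false f g hf hg u hu hodd h hΦ
  · exact to22_typeO_E768_ge2932_false f g hf hg u hu hodd h hΦ
  · exact to22_typeO_E896_ge2932_false f g hf hg u hu hodd h hΦ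
  · exact to22_typeO_E960_ge2932_false f g hf hg u hu hodd h hΦ
  · exact to22_typeO_E992_ge2932_false f g hf hg u hu hodd h hΦ
  · exact to23_typeO_E1024_ge2932_false f g hf hg u hu hodd h hΦ

/-- **Both sides at Ax level `≥ 5` at `Φ ≥ 29/32`**: for a cubic pair on 12 bits with `Φ(f,g) ≥ 29/32`, `W_g ∈ 32ℤ` and `W_f ∈ 32ℤ`.
[this work] -/
theorem tw23_ge2932_levelFive (f g : (Fin (6 + 6) → Bool) → Bool) (hf : IsDegLeFun 3 f) (hg : IsDegLeFun 3 g)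
    (hΦ : (29 / 32 : ℝ) ≤ forrelation f g) :
    (∃ u' : (Fin (6 + 6) → Bool) → ℤ, ∀ x, W (fun y => signOf (g y)) x = (2 : ℝ) ^ 5 * (u' x : ℝ)) ∧
      (∃ uf : (Fin (6 + 6) → Bool) → ℤ, ∀ y, W (fun x => signOf (f x)) y = (2 : ℝ) ^ 5 * (uf y : ℝ)) := by
  have hΦ' : forrelation g f = forrelation f g := by
    rw [Summit.QuantumAdvantage.QuantumAdvantage.Theorems.SignedCubicForrelationNotPrBPP.Negative.HalfQuad.forrelation_comm]
  constructor
  · obtain ⟨ub, hub⟩ := tw_base (n := 6 + 6) g hg 4 (by norm_num)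
    have hO : ∀ x, ¬ Odd (ub x) := fun x hx => to23_typeO_ge2932_false f g hf hg ub hub ⟨x, hx⟩ hΦ
    exact ⟨fun x => ub x / 2, tw_level_up (j := 4) g ub hub hO⟩
  · obtain ⟨ub, hub⟩ := tw_base (n := 6 + 6) f hf 4 (by norm_num)
    have hO : ∀ x, ¬ Odd (ub x) := fun x hx => to23_typeO_ge2932_false g f hg hf ub hub ⟨x, hx⟩ (by rw [hΦ']; exact hΦ)
    exact ⟨fun x => ub x / 2, tw_level_up (j := 4) f ub hub hO⟩

/-- **No type-O side at `Φ ≥ 29/32`, packaged**: there are no cubic `f, g : 𝔽₂¹² → 𝔽₂` with `W_g = 16u`, some `u(x)` odd and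
`29/32 ≤ Φ(f,g)`. [this work] -/
theorem no_typeO_twelve_ge_2932 : ¬ ∃ (f g : (Fin 12 → Bool) → Bool) (u : (Fin 12 → Bool) → ℤ),
    IsDegLeFun 3 f ∧ IsDegLeFun 3 g ∧ (∀ x, W (fun y => signOf (g y)) x = (2 : ℝ) ^ 4 * (u x : ℝ)) ∧
      (∃ x, Odd (u x)) ∧ (29 / 32 : ℝ) ≤ forrelation f g := by
  rintro ⟨f, g, u, hf, hg, hu, hodd, hΦ⟩
  exact to23_typeO_ge2932_false f g hf hg u hu hodd hΦ

end Summit.QuantumAdvantage.QuantumAdvantage.Theorems.CubicForrelation.NearExactIsExact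

end
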